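import Literature.MathematicalPhysics.QuantumLattice.HubbardAndersonClusterBound
import Literature.MathematicalPhysics.QuantumLattice.HubbardWave0LiebProofs
import Mathlib.Combinatorics.SimpleGraph.Operations
import HarnessLib

/-!
# Symmetries of the Anderson cluster operator of the certificate rows

Support file for the certified many-body solver (venture `CertifiedManyBodySolver`, lane A rows):
first certified bounds; not a superconductivity verdict; every number certified or labelled float.

The operator `andersonCluster Λ' t U w v` (`HubbardAndersonClusterBound`, §5) — the
`4^{|Λ'|}`-square matrix whose least eigenvalue the `anderson_*` rows certify — is written bond by
bond as a sum of one-bond Hubbard Hamiltonians `hamiltonian (SimpleGraph.edge y z) 1 0`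
(`clusterBondKinetic_eq_dite`), from which its symmetries follow from the tree's Lieb-1989 lemmas
(`LiebThm1`): it is Hermitian, conserves `(N↑, N↓)` (`PreservesSectors`), commutes with `N`, `S⁺`
and `S⁻`. These feed the `S^z`-ladder and the spin-reflection-positivity block lemma of
`AndersonHalfFilledBlock`.

References: E. H. Lieb, Phys. Rev. Lett. **62** (1989) 1201, eq. (2) and Remark (2);
P. W. Anderson, Phys. Rev. **83** (1951) 1260, eq. (2).
-/

namespace Summit.Ventures.CertifiedManyBodySolver.Rows

open Matrix Finset Literature.MathematicalPhysics.QuantumLattice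
  Literature.MathematicalPhysics.QuantumLattice.AndersonCluster Literature.Probability.LatticeModels
open scoped ComplexOrder

/-! ### The one-bond graph -/

section Bond

variable {Λ : Type*} [LinearOrder Λ] [Fintype Λ]

omit [LinearOrder Λ] [Fintype Λ] in
/-- For `a ≠ b` the ordered edges of the one-bond graph `SimpleGraph.edge a b` are `(a, b)` and
`(b, a)`. [folklore] -/
theorem edge_adj_iff_of_ne {a b : Λ} (hab : a ≠ b) (x y : Λ) :
    (SimpleGraph.edge a b).Adj x y ↔ (x = a ∧ y = b ∨ x = b ∧ y = a) := by
  rw [SimpleGraph.edge_adj]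
  constructor
  · exact fun h => h.1
  · rintro (⟨rfl, rfl⟩ | ⟨rfl, rfl⟩)
    · exact ⟨Or.inl ⟨rfl, rfl⟩, hab⟩
    · exact ⟨Or.inr ⟨rfl, rfl⟩, hab.symm⟩

/-- A sum over the ordered edges of `SimpleGraph.edge a b`, `a ≠ b`, has the two terms `(a, b)`,
`(b, a)` (stated for any decidability instance of the adjacency). [folklore] -/
theorem sum_sum_ite_edge_adj {β : Type*} [AddCommMonoid β] {a b : Λ} (hab : a ≠ b)
    [DecidableRel (SimpleGraph.edge a b).Adj] (F : Λ → Λ → β) :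
    (∑ x, ∑ y, if (SimpleGraph.edge a b).Adj x y then F x y else 0) = F a b + F b a := by
  have inner : ∀ x, (∑ y, if (SimpleGraph.edge a b).Adj x y then F x y else 0) =
      (if x = a then F a b else 0) + (if x = b then F b a else 0) := by
    intro x
    by_cases hxa : x = a
    · subst hxa
      rw [if_pos rfl, if_neg hab, add_zero, Finset.sum_eq_single b]
      · rw [if_pos ((edge_adj_iff_of_ne hab _ _).2 (Or.inl ⟨rfl, rfl⟩))]
      · intro y _ hyb
        rw [if_neg]
        intro h
        rcases (edge_adj_iff_of_ne hab _ _).1 h with ⟨-, h'⟩ | ⟨h', -⟩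
        · exact hyb h'
        · exact hab h'
      · exact fun h => absurd (Finset.mem_univ b) h
    · by_cases hxb : x = b
      · subst hxb
        rw [if_neg hxa, if_pos rfl, zero_add, Finset.sum_eq_single a]
        · rw [if_pos ((edge_adj_iff_of_ne hab _ _).2 (Or.inr ⟨rfl, rfl⟩))]
        · intro y _ hya
          rw [if_neg]
          intro h
          rcases (edge_adj_iff_of_ne hab _ _).1 h with ⟨h', -⟩ | ⟨-, h'⟩
          · exact hxa h'
          · exact hya h'
        · exact fun h => absurd (Finset.mem_univ a) h
      · rw [if_neg hxa, if_neg hxb, add_zero]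
        refine Finset.sum_eq_zero fun y _ => ?_
        rw [if_neg]
        intro h
        rcases (edge_adj_iff_of_ne hab _ _).1 h with ⟨h', -⟩ | ⟨h', -⟩
        · exact hxa h'
        · exact hxb h'
  simp_rw [inner]
  rw [Finset.sum_add_distrib, Finset.sum_ite_eq' Finset.univ a, Finset.sum_ite_eq' Finset.univ b,
    if_pos (Finset.mem_univ a), if_pos (Finset.mem_univ b)]

/-- **The one-bond Hubbard Hamiltonian** at `t = 1`, `U = 0` is minus the bond kinetic term:
`hamiltonian (SimpleGraph.edge a b) 1 0 = -Σ_σ (c†_{aσ} c_{bσ} + c†_{bσ} c_{aσ})`, `a ≠ b`.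
[cite: LiebPRL1989, eq. (1)] -/
theorem hamiltonian_edge_one_zero {a b : Λ} (hab : a ≠ b)
    [DecidableRel (SimpleGraph.edge a b).Adj] : hamiltonian (SimpleGraph.edge a b) 1 0 =
      -∑ σ : Fin 2, (creation (orb a σ) * annihilation (orb b σ) +
        creation (orb b σ) * annihilation (orb a σ) :
          Matrix (Finset (Orb Λ)) (Finset (Orb Λ)) ℂ) := by
  unfold hamiltonian
  have hσ : ∀ x y : Λ, (∑ σ : Fin 2, if (SimpleGraph.edge a b).Adj x y then
      (creation (orb x σ) * annihilation (orb y σ) : Matrix (Finset (Orb Λ)) (Finset (Orb Λ)) ℂ)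
      else 0) =
      if (SimpleGraph.edge a b).Adj x y then
        ∑ σ : Fin 2, creation (orb x σ) * annihilation (orb y σ)
      else 0 := by
    intro x y
    split_ifs <;> simp
  simp_rw [hσ]
  rw [sum_sum_ite_edge_adj hab, Complex.ofReal_one, Complex.ofReal_zero, zero_smul, add_zero,
    neg_one_smul, Finset.sum_add_distrib]

end Bond

/-! ### The Anderson cluster operator bond by bond -/

section Cluster

variable {d : ℕ} {Λ' : Finset (Site d)}

/-- A site and its translate by a unit vector are different ordered sites. [folklore] -/
theorem ne_pt_add_unitVec (y : PolySite Λ') (i : Fin d) (h : ofLex y.1 + unitVec i ∈ Λ') :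
    y ≠ PolySite.pt (ofLex y.1 + unitVec i) h := by
  intro heq
  have h1 : ofLex y.1 = ofLex y.1 + unitVec i := by
    conv_lhs => rw [heq]
    rfl
  have h2 := congrFun h1 i
  simp [unitVec] at h2

/-- **The bond kinetic term is minus a one-bond Hubbard Hamiltonian**:
`T_{x,x+eᵢ} = -hamiltonian (SimpleGraph.edge y (x+eᵢ)) 1 0` when `x + eᵢ ∈ Λ'`, else `0`.
[cite: Anderson1951, eq. (2)] -/
theorem clusterBondKinetic_eq_dite (y : PolySite Λ') (i : Fin d) :
    clusterBondKinetic Λ' y i = if h : ofLex y.1 + unitVec i ∈ Λ' then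
      -hamiltonian (SimpleGraph.edge y (PolySite.pt (ofLex y.1 + unitVec i) h)) 1 0 else 0 := by
  unfold clusterBondKinetic
  split_ifs with h
  · rw [hamiltonian_edge_one_zero (ne_pt_add_unitVec y i h), neg_neg]
  · rfl

/-- The bond kinetic term is Hermitian. [cite: LiebPRL1989, eq. (1)] -/
theorem clusterBondKinetic_isHermitian (y : PolySite Λ') (i : Fin d) :
    (clusterBondKinetic Λ' y i).IsHermitian := by
  rw [clusterBondKinetic_eq_dite]
  split_ifs with h
  · exact (LiebThm1.hamiltonian_isHermitian _ 1 0).neg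
  · exact isHermitian_zero

/-- The bond kinetic term conserves `(N↑, N↓)`. [cite: LiebPRL1989, Remark (2)] -/
theorem preservesSectors_clusterBondKinetic (y : PolySite Λ') (i : Fin d) :
    PreservesSectors (clusterBondKinetic Λ' y i) := by
  rw [clusterBondKinetic_eq_dite]
  split_ifs with h
  · rw [← neg_one_smul ℂ]
    exact (LiebThm1.preservesSectors_hamiltonian _ 1 0).smul _
  · exact PreservesSectors.zero

/-- The bond kinetic term commutes with `S⁺`. [cite: LiebPRL1989, eq. (2)] -/
theorem clusterBondKinetic_commute_spinPlus (y : PolySite Λ') (i : Fin d) :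
    Commute (clusterBondKinetic Λ' y i) spinPlus := by
  rw [clusterBondKinetic_eq_dite]
  split_ifs with h
  · exact (LiebThm1.hamiltonian_commute_spinPlus _ 1 0).neg_left
  · exact Commute.zero_left _

/-- The particle–hole symmetric site term `2 n↑n↓ - (n↑ + n↓) + 1` is Hermitian. [folklore] -/
theorem phSiteTerm_isHermitian {Λ : Type*} [LinearOrder Λ] [Fintype Λ] (y : Λ) :
    ((2 : ℂ) • (numberOp y 0 * numberOp y 1) - (numberOp y 0 + numberOp y 1) + 1 :
      Matrix (Finset (Orb Λ)) (Finset (Orb Λ)) ℂ).IsHermitian := by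
  have h0 : (numberOp y 0 : Matrix (Finset (Orb Λ)) (Finset (Orb Λ)) ℂ)ᴴ = numberOp y 0 :=
    (numberAt_isHermitian (orb y 0)).eq
  have h1 : (numberOp y 1 : Matrix (Finset (Orb Λ)) (Finset (Orb Λ)) ℂ)ᴴ = numberOp y 1 :=
    (numberAt_isHermitian (orb y 1)).eq
  have h01 : (numberOp y 0 * numberOp y 1 : Matrix (Finset (Orb Λ)) (Finset (Orb Λ)) ℂ)ᴴ =
      numberOp y 0 * numberOp y 1 := by
    rw [conjTranspose_mul, h0, h1]
    exact (numberAt_commute (orb y 1) (orb y 0)).eq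
  rw [IsHermitian, conjTranspose_add, conjTranspose_sub, conjTranspose_add, conjTranspose_smul,
    conjTranspose_one, h0, h1, h01]
  norm_num

/-- The site term conserves `(N↑, N↓)`. [folklore] -/
theorem preservesSectors_phSiteTerm {Λ : Type*} [LinearOrder Λ] [Fintype Λ] (y : Λ) :
    PreservesSectors ((2 : ℂ) • (numberOp y 0 * numberOp y 1) - (numberOp y 0 + numberOp y 1) + 1 :
      Matrix (Finset (Orb Λ)) (Finset (Orb Λ)) ℂ) := by
  refine PreservesSectors.add ?_ ?_
  · rw [sub_eq_add_neg, ← neg_one_smul ℂ (numberOp y 0 + numberOp y 1 : Matrix _ _ ℂ)]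
    exact (((LiebThm1.preservesSectors_numberOp y 0).mul
      (LiebThm1.preservesSectors_numberOp y 1)).smul _).add
      (((LiebThm1.preservesSectors_numberOp y 0).add
        (LiebThm1.preservesSectors_numberOp y 1)).smul _)
  · rw [← diagonal_one]
    exact PreservesSectors.diagonal _

/-- `n_{x↑} + n_{x↓}` commutes with `S⁺` (`[n_{x↑}, c†_{z↑}c_{z↓}] = δ_{xz} c†_{x↑}c_{x↓} =
-[n_{x↓}, c†_{z↑}c_{z↓}]`). Tasaki (2020) §9.3. [cite: Tasaki2020, §9.3] -/
theorem sum_numberOp_commute_spinPlus {Λ : Type*} [LinearOrder Λ] [Fintype Λ] (x : Λ) :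
    Commute (numberOp x 0 + numberOp x 1 : Matrix (Finset (Orb Λ)) (Finset (Orb Λ)) ℂ)
      spinPlus := by
  rw [Commute, SemiconjBy, spinPlus, Finset.mul_sum, Finset.sum_mul, ← sub_eq_zero,
    ← Finset.sum_sub_distrib]
  refine Finset.sum_eq_zero fun z _ => ?_
  rw [Matrix.add_mul, Matrix.mul_add, add_sub_add_comm]
  unfold numberOp
  rw [LiebThm1.creation_mul_annihilation_commutator, LiebThm1.creation_mul_annihilation_commutator]
  by_cases hxz : x = z
  · subst hxz
    simp
  · simp [hxz]

/-- The site term commutes with `S⁺`. [cite: Tasaki2020, §9.3] -/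
theorem phSiteTerm_commute_spinPlus {Λ : Type*} [LinearOrder Λ] [Fintype Λ] (y : Λ) :
    Commute ((2 : ℂ) • (numberOp y 0 * numberOp y 1) - (numberOp y 0 + numberOp y 1) + 1 :
      Matrix (Finset (Orb Λ)) (Finset (Orb Λ)) ℂ) spinPlus :=
  (((LiebThm1.numberOp_mul_numberOp_commute_spinPlus y).smul_left _).sub_left
    (sum_numberOp_commute_spinPlus y)).add_left (Commute.one_left _)

variable (Λ') in
/-- **The Anderson cluster operator is Hermitian** (real weights). [cite: Anderson1951, eq. (2)] -/
theorem andersonCluster_isHermitian (t U : ℝ) (w : Site d → Fin d → ℝ) (v : Site d → ℝ) :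
    (andersonCluster Λ' t U w v).IsHermitian := by
  unfold andersonCluster
  have hK : (∑ y : PolySite Λ', ∑ i : Fin d,
      ((w (ofLex y.1) i : ℝ) : ℂ) • clusterBondKinetic Λ' y i)ᴴ =
      ∑ y : PolySite Λ', ∑ i : Fin d, ((w (ofLex y.1) i : ℝ) : ℂ) • clusterBondKinetic Λ' y i := by
    simp only [conjTranspose_sum, conjTranspose_smul, Complex.star_def, Complex.conj_ofReal,
      (clusterBondKinetic_isHermitian _ _).eq]
  have hV : (∑ y : PolySite Λ', ((v (ofLex y.1) : ℝ) : ℂ) •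
      ((2 : ℂ) • (numberOp y 0 * numberOp y 1) - (numberOp y 0 + numberOp y 1) + 1 :
        FermionOp Λ'))ᴴ =
      ∑ y : PolySite Λ', ((v (ofLex y.1) : ℝ) : ℂ) •
        ((2 : ℂ) • (numberOp y 0 * numberOp y 1) - (numberOp y 0 + numberOp y 1) + 1) := by
    simp only [conjTranspose_sum, conjTranspose_smul, Complex.star_def, Complex.conj_ofReal,
      (phSiteTerm_isHermitian _).eq]
  rw [IsHermitian, conjTranspose_add, conjTranspose_smul, conjTranspose_smul, hK, hV]
  simp only [Complex.star_def, map_neg, Complex.conj_ofReal]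

variable (Λ') in
/-- **The Anderson cluster operator conserves `(N↑, N↓)`.** [cite: LiebPRL1989, Remark (2)] -/
theorem preservesSectors_andersonCluster (t U : ℝ) (w : Site d → Fin d → ℝ) (v : Site d → ℝ) :
    PreservesSectors (andersonCluster Λ' t U w v) := by
  unfold andersonCluster
  refine ((PreservesSectors.sum fun y _ => PreservesSectors.sum fun i _ =>
    (preservesSectors_clusterBondKinetic y i).smul _).smul _).add
    ((PreservesSectors.sum fun y _ => (preservesSectors_phSiteTerm y).smul _).smul _)

variable (Λ') in
/-- **`[h, S⁺] = 0`** for the Anderson cluster operator. [cite: LiebPRL1989, eq. (2)] -/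
theorem andersonCluster_commute_spinPlus (t U : ℝ) (w : Site d → Fin d → ℝ) (v : Site d → ℝ) :
    Commute (andersonCluster Λ' t U w v) spinPlus := by
  unfold andersonCluster
  refine Commute.add_left (Commute.smul_left (Commute.sum_left _ _ _ fun y _ =>
    Commute.sum_left _ _ _ fun i _ => (clusterBondKinetic_commute_spinPlus y i).smul_left _) _)
    (Commute.smul_left (Commute.sum_left _ _ _ fun y _ =>
      (phSiteTerm_commute_spinPlus y).smul_left _) _)

variable (Λ') in
/-- **`[h, S⁻] = 0`** (adjoint of `[h, S⁺] = 0`). [cite: LiebPRL1989, eq. (2)] -/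
theorem andersonCluster_commute_spinMinus (t U : ℝ) (w : Site d → Fin d → ℝ) (v : Site d → ℝ) :
    Commute (andersonCluster Λ' t U w v) spinMinus := by
  have h := andersonCluster_commute_spinPlus Λ' t U w v
  rw [Commute, SemiconjBy] at h ⊢
  have h' := congrArg conjTranspose h
  rw [conjTranspose_mul, conjTranspose_mul, (andersonCluster_isHermitian Λ' t U w v).eq] at h'
  exact h'.symm

variable (Λ') in
/-- **`[h, N] = 0`**: a `(N↑, N↓)`-conserving operator commutes with the (diagonal) particle number.
[cite: LiebPRL1989, Remark (2)] -/
theorem andersonCluster_commute_totalNumber (t U : ℝ) (w : Site d → Fin d → ℝ) (v : Site d → ℝ) :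
    Commute (andersonCluster Λ' t U w v) totalNumber := by
  rw [LiebThm1.totalNumber_eq_diagonal]
  exact (preservesSectors_andersonCluster Λ' t U w v).commute_diagonal fun a b => ((a + b : ℕ) : ℂ)

end Cluster

end Summit.Ventures.CertifiedManyBodySolver.Rows
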